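import Summits.BirchSwinnertonDyer.BirchSwinnertonDyer.Theorems.CMKolyvaginAtInertTwoCebotarevBinderPairDeeperAtTwo
import Summits.BirchSwinnertonDyer.BirchSwinnertonDyer.Theorems.CMKolyvaginAtInertTwoLiftGroupsPairVAtTwo
import HarnessLib

/-!
# Route `CMKolyvaginAtInertTwo`, crux `CMKolyvaginExactAtInertTwo` (stmt-BirchSwinnertonDyer-24277):
# McCALLUM'S INEQUALITY FOR THE PAIR AT `p = 2`: `#A · #S₂ ≤ 2^{2M₀}` from the adaptive telescope with
# depth-`(M+1)` Kolyvagin primes and the unconditional lift groups (T5′) — the assembly shape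

Seat `bsd-line-cmk2-p1` g14 (cell `bsd-print-cf2`); helper (`--supports stmt-BirchSwinnertonDyer-24277`).
THEOREMS ONLY: no definition, no named fact, no `sorry`; no item is closed; BSD is not proved by this.

This is the composition of the two halves built by this seat, and fixes the EXACT interface the
remaining T2 construction (KERNEL-STATUS §13.2 (b), (c)) must instantiate. INPUT: split descent data
`Sd` on `V = H¹(K,E[2^M])^{ε} × H¹(K,E[2^M])^{−ε}` with Gross-form Kolyvagin primes of depth `M+1`
(`card_mul_card_le_two_pow_of_pair_succ`, p688445), a pairing `P` on `Sd.Sel` with McCallum's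
Cassels–Tate value formula `hCTV`; and the ABSTRACT `ℚ`-side data of `exists_liftGroups_pairV`
(p687372): `π : S₁ ↠ A` with kernel `⟨x⟩`, `x` of maximal order (`S₁ = Sel_{2^M}(E^{ε}/ℚ)`,
`A = Ш(E^{ε}/ℚ)[2^∞]`), alternating nondegenerate `ℚ/ℤ`-pairings on `A` and `S₂ = Ш(E^{−ε}/ℚ)[2^∞]`
killed by `2^k`, injections `j₁ : S₁ → V^{ε}`, `j₂ : S₂ → V^{−ε}` with images in `Sd.Sel`,
`Sd.x = (j₁ x, 0)`, `Sd.ε = ε`, room `k + M₀ ≤ M`, and ONE compatibility: `P` vanishes on a pair of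
classes `(j₁ u, j₂ v)`, `(j₁ u', j₂ v')` whenever `B_A(π u, π u') = 0` and `B_B(v, v') = 0` (true for
`P = CT_{E^{ε}} ⊕ CT_{E^{−ε}}` transported, which has no cross terms). OUTPUT:
**`#A · #S₂ ≤ 2^{2 M₀}`** — McCallum's Thm. 5.4 "≤" for the pair `(E^{ε}, E^{−ε})` over `ℚ` at `p = 2`
(`#Ш(E/ℚ)[2^∞] · #Ш(E^{d_K}/ℚ)[2^∞] ≤ 2^{2M₀}` once instantiated).

* `card_mul_card_le_two_pow_two_mul` — the statement above.

References: [McCallumLMS1991] §1 Theorem, §5 Thm. 5.4 (p. 307), Cor. 5.6; [Kolyvagin1989Izv] §3.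
-/

-- single-conjunct summit: `Summit.BirchSwinnertonDyer.BirchSwinnertonDyer.…` repeats the name by design
set_option linter.dupNamespace false
set_option autoImplicit false

noncomputable section

open scoped Classical
open WeierstrassCurve NumberField IsDedekindDomain Field
open Literature.NumberTheory.GaloisRepresentations
open Literature.NumberTheory.EllipticCurves Literature.NumberTheory.EllipticCurves.KolyvaginDescent

namespace Summit.BirchSwinnertonDyer.BirchSwinnertonDyer.Theorems.KolyvaginPairDataTwo

open KolyvaginAdaptiveData

variable {N : ℕ} (W : WeierstrassCurve ℚ) {K : Type} [Field K] [NumberField K] (c : K ≃ₐ[ℚ] K) (M : ℕ)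

-- the product-of-subtypes carrier `PairV` makes instance unification slow (`addOrderOf`, `•`)
set_option maxHeartbeats 800000 in
/-- **McCallum's inequality for the pair at `p = 2`: `#A · #S₂ ≤ 2^{2M₀}`.** See the module docstring
for the inputs. Proof: the lift groups `Zp ≤ S₁`, `Zm ≤ S₂` of `exists_liftGroups_pairV` (isotropic,
`(#Zp)² = #A`, `(#Zm)² = #S₂`, with `hind` and (IND) `hIND` in `V`) are fed to the adaptive telescope
with depth-`(M+1)` Kolyvagin primes, which gives `#Zp · #Zm ≤ 2^{M₀}`; square.
[cite: McCallumLMS1991, §5 Thm. 5.4 (proof, p. 307), Cor. 5.6] [cite: Kolyvagin1989Izv, §3] -/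
theorem card_mul_card_le_two_pow_two_mul (hC : Literature.NumberTheory.Automorphic.chebotarev_artinRep)
    [NeZero N] [W.IsElliptic] (hK : IsImaginaryQuadratic K) (hρ : W.HasSurjectiveModNGaloisRep 2)
    (hΔ : W.Δ < 0) (hΔK : ¬ IsSquare (W.baseChange K).Δ) (hc : c ≠ 1)
    {c₀ : absoluteGaloisGroup ℚ} (hc₀ : IsComplexConjugation (Rat.castHom ℝ) c₀)
    {z : absoluteGaloisGroup K}
    (hzfix : ∀ P : geomTorsion (W.baseChange K) ((2 : ℕ) : ℤ), z • P = P → P = 0)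
    (hcomm : ∀ π ∈ torsionFixing (W.baseChange K) ((2 : ℕ) : ℤ),
      ∀ P : geomTorsion (W.baseChange K) ((2 ^ (M + 1) : ℕ) : ℤ), π • z • P = z • π • P)
    {S : ℕ → Prop}
    (hS : ∀ ℓ, IsKolyvaginPrime N W K 2 ℓ → FrobEqFrobInfty W K (2 ^ (M + 1)) ℓ → S ℓ)
    {P₀ : (W.baseChange K).toAffine.Point} (hP₀ : IsHeegnerPoint N W K P₀)
    {ε : ℤ} (hε : ε = 1 ∨ ε = -1) (Sd : SplitDataM (PairV W c M ε) (Places K))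
    (hp : Sd.p = 2) (hEig : Sd.eig = pairEig W c M ε)
    (hA : Sd.A = pairA (N := N) W c M ε)
    (hKol : ∀ ℓ, Sd.Kol ℓ ↔ IsKolyvaginPrime N W K 2 ℓ ∧ FrobEqFrobInfty W K (2 ^ (M + 1)) ℓ ∧ S ℓ)
    (hSdε : Sd.ε = ε)
    {R : Type*} [AddCommGroup R] (P : Sd.Sel →+ Sd.Sel →+ R)
    (hCTV : ∀ ℓ m : ℕ, Sd.Kol ℓ → KolSupp Sd.Kol (ℓ * m) → ¬ ℓ ∣ m →
      ∀ (j N' a b : ℕ) (t : PairV W c M ε) (ht : t ∈ Sd.Sel)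
        (hz : ((Sd.p : ℤ) ^ j) • Sd.c (ℓ * m) ∈ Sd.Sel),
      ((Sd.p : ℤ) ^ N') • t = 0 → t ∈ Sd.eig (Sd.ε * (-1) ^ (ℓ * m).primeFactors.card) →
      (∀ q ∈ m.primeFactors, t ∈ Sd.A q) → Sd.M - Sd.M₀ ≤ j → N' + Sd.M₀ ≤ Sd.M → N' ≤ j →
      a + b + 1 = N' →
      ((Sd.p : ℤ) ^ (a + (j - N'))) • Sd.c m ∉ Sd.A ℓ → ((Sd.p : ℤ) ^ b) • t ∉ Sd.A ℓ →
      P ⟨_, hz⟩ ⟨t, ht⟩ ≠ 0)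
    -- the abstract `ℚ`-side data
    {S₁ : Type} [AddCommGroup S₁] [Finite S₁] {S₂ : Type} [AddCommGroup S₂] [Finite S₂]
    {A : Type} [AddCommGroup A]
    (π : S₁ →+ A) (hπ : Function.Surjective π) (x : S₁)
    (hker : π.ker = AddSubgroup.zmultiples x) (hx : addOrderOf x = AddMonoid.exponent S₁)
    (BA : A →+ A →+ AddCircle (1 : ℚ)) (hAalt : ∀ a, BA a a = 0)
    (hAnd : ∀ a, (∀ b, BA a b = 0) → a = 0)
    (BB : S₂ →+ S₂ →+ AddCircle (1 : ℚ)) (hBalt : ∀ v, BB v v = 0)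
    (hBnd : ∀ v, (∀ w, BB v w = 0) → v = 0) {k : ℕ} (hpA : ∀ a : A, 2 ^ k • a = 0)
    (hpB : ∀ v : S₂, 2 ^ k • v = 0)
    (j₁ : S₁ →+ ↥(eigK W c M ε)) (j₂ : S₂ →+ ↥(eigK W c M (-ε)))
    (hj₁ : Function.Injective j₁) (hj₂ : Function.Injective j₂)
    -- compatibility
    (hxSd : Sd.x = (j₁ x, 0))
    (hSel : ∀ (u : S₁) (v : S₂), ((j₁ u, j₂ v) : PairV W c M ε) ∈ Sd.Sel)
    (hP : ∀ (u u' : S₁) (v v' : S₂), BA (π u) (π u') = 0 → BB v v' = 0 →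
      P ⟨(j₁ u, j₂ v), hSel u v⟩ ⟨(j₁ u', j₂ v'), hSel u' v'⟩ = 0)
    (hkM : k + Sd.M₀ ≤ Sd.M) :
    Nat.card A * Nat.card S₂ ≤ 2 ^ (2 * Sd.M₀) := by
  -- ### the lift groups (T5′) placed in the pair
  obtain ⟨Zp, Zm, hdisj, hisoA, hcardA, hisoB, hcardB, hcZp, hcZm, heZp, heZm, hind, hIND⟩ :=
    exists_liftGroups_pairV W c M ε Nat.prime_two π hπ x hker hx BA hAalt hAnd BB hBalt hBnd hpA hpB
      j₁ j₂ hj₁ hj₂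
  set Zp' : AddSubgroup (PairV W c M ε) := (Zp.map j₁).prod (⊥ : AddSubgroup ↥(eigK W c M (-ε)))
    with hZp'
  set Zm' : AddSubgroup (PairV W c M ε) := (⊥ : AddSubgroup ↥(eigK W c M ε)).prod (Zm.map j₂)
    with hZm'
  haveI : Finite ↥(Zp.map j₁) :=
    Finite.of_surjective (fun a : Zp ↦ (⟨j₁ a, AddSubgroup.mem_map_of_mem j₁ a.2⟩ : ↥(Zp.map j₁)))
      fun y ↦ by
        obtain ⟨a, ha, hay⟩ := AddSubgroup.mem_map.mp y.2
        exact ⟨⟨a, ha⟩, Subtype.ext hay⟩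
  haveI : Finite ↥(Zm.map j₂) :=
    Finite.of_surjective (fun b : Zm ↦ (⟨j₂ b, AddSubgroup.mem_map_of_mem j₂ b.2⟩ : ↥(Zm.map j₂)))
      fun y ↦ by
        obtain ⟨b, hb, hby⟩ := AddSubgroup.mem_map.mp y.2
        exact ⟨⟨b, hb⟩, Subtype.ext hby⟩
  haveI : Finite Zp' := finite_prod _ _
  haveI : Finite Zm' := finite_prod _ _
  -- elements of `Zp' ⊔ Zm'` are `(j₁ a, j₂ b)`, `a ∈ Zp`, `b ∈ Zm`
  have hsup : Zp' ⊔ Zm' = (Zp.map j₁).prod (Zm.map j₂) := prod_bot_sup_bot_prod _ _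
  have hdec : ∀ w ∈ Zp' ⊔ Zm', ∃ a ∈ Zp, ∃ b ∈ Zm, w = (j₁ a, j₂ b) := by
    intro w hw
    rw [hsup, AddSubgroup.mem_prod, AddSubgroup.mem_map, AddSubgroup.mem_map] at hw
    obtain ⟨⟨a, ha, haw⟩, ⟨b, hb, hbw⟩⟩ := hw
    exact ⟨a, ha, b, hb, Prod.ext haw.symm hbw.symm⟩
  -- ### the telescope's hypotheses
  have hZp : ∀ v ∈ Zp', v ∈ Sd.Sel ∧ v ∈ Sd.eig Sd.ε := by
    intro v hv
    obtain ⟨a, -, b, -, rfl⟩ := hdec v (AddSubgroup.mem_sup_left hv)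
    refine ⟨hSel a b, ?_⟩
    rw [hEig, hSdε]
    exact heZp _ hv
  have hZm : ∀ v ∈ Zm', v ∈ Sd.Sel ∧ v ∈ Sd.eig (-Sd.ε) := by
    intro v hv
    obtain ⟨a, -, b, -, rfl⟩ := hdec v (AddSubgroup.mem_sup_right hv)
    refine ⟨hSel a b, ?_⟩
    rw [hEig, hSdε]
    exact heZm hε _ hv
  have hiso : ∀ u, ∀ hu : u ∈ Zp' ⊔ Zm', ∀ v, ∀ hv : v ∈ Zp' ⊔ Zm',
      ∀ (hu' : u ∈ Sd.Sel) (hv' : v ∈ Sd.Sel), P ⟨u, hu'⟩ ⟨v, hv'⟩ = 0 := by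
    intro u hu v hv hu' hv'
    obtain ⟨a, ha, b, hb, rfl⟩ := hdec u hu
    obtain ⟨a', ha', b', hb', rfl⟩ := hdec v hv
    exact hP a a' b b' (hisoA a ha a' ha') (hisoB b hb b' hb')
  have hind' : AddSubgroup.zmultiples Sd.x ⊓ (Zp' ⊔ Zm') = ⊥ := by
    rw [hxSd]
    exact hind
  have hroom : ∀ v ∈ Zp' ⊔ Zm', Sd.expo v + Sd.M₀ ≤ Sd.M := by
    intro v hv
    obtain ⟨a, ha, b, hb, rfl⟩ := hdec v hv
    -- `2^k a = 0` (`π(2^k a) = 0`, `ker π ∩ Zp = 0`) and `2^k b = 0`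
    have ha0 : 2 ^ k • a = 0 := by
      have h1 : 2 ^ k • a ∈ π.ker := by
        rw [AddMonoidHom.mem_ker, map_nsmul, hpA]
      rw [hker] at h1
      have h2 := hdisj.le_bot (AddSubgroup.mem_inf.mpr ⟨h1, AddSubgroup.nsmul_mem _ ha _⟩)
      rwa [AddSubgroup.mem_bot] at h2
    have hv0 : ((Sd.p : ℤ) ^ k) • ((j₁ a, j₂ b) : PairV W c M ε) = 0 := by
      rw [hp, ← Nat.cast_pow, natCast_zsmul]
      refine Prod.ext ?_ ?_
      · show 2 ^ k • j₁ a = 0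
        rw [← map_nsmul, ha0, map_zero]
      · show 2 ^ k • j₂ b = 0
        rw [← map_nsmul, hpB, map_zero]
    have hle : Sd.expo ((j₁ a, j₂ b) : PairV W c M ε) ≤ k := (Sd.expo_le_iff _ k).mpr hv0
    omega
  -- ### the telescope, squared
  have h := card_mul_card_le_two_pow_of_pair_succ W c M hC hK hρ hΔ hΔK hc hc₀ hzfix hcomm hS hP₀ hε Sd
    hp hEig hA hKol P hCTV Zp' Zm' hZp hZm hiso hind' hIND hroom
  rw [hcZp, hcZm] at h
  calc Nat.card A * Nat.card S₂ = (Nat.card Zp * Nat.card Zm) ^ 2 := by rw [mul_pow, hcardA, hcardB]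
    _ ≤ (2 ^ Sd.M₀) ^ 2 := Nat.pow_le_pow_left h 2
    _ = 2 ^ (2 * Sd.M₀) := by rw [← pow_mul, mul_comm]

end Summit.BirchSwinnertonDyer.BirchSwinnertonDyer.Theorems.KolyvaginPairDataTwo

end
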